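import Literature.Computability.AlgebraicComplexity.DetReprEquivalent
import Literature.Computability.AlgebraicComplexity.LandsbergRessayre

/-!
# Transport of half-equivariance along constant gauge and matrix transposition (S5)

Stub `stub_halfEq_transport_gauge` of line `Sketch` for crux `ProjectionStability.OptStep`
(stmt-ValiantsHypothesis-17835).

A square matrix `B` of polynomials in the `k²` variables `x_{ij}` is *half-equivariant* when `B`,
or its variable-transpose `B.map (rename Prod.swap)` (substitute `x_{ij} ↦ x_{ji}` in every cell),
is an exactly-lifted `leftMonomialSubst`-equivariant affine determinantal representation of
`per_k` (`IsEquivariantDetRepr`, `EquivariantDC.lean`). We prove that half-equivariance is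
transported along the constant-gauge-and-matrix-transposition part of the level-`n` uniqueness
relation: if `A` is half-equivariant and `B = P · A · Q` or `B = P · Aᵀ · Q` with
`P, Q ∈ GL_m(ℂ)` and `det B = per_k`, then `B` is half-equivariant.

Proof: in the first alternative (`A` itself equivariant) `B` is `DetReprEquivalent Γ A B` with the
trivial substitution `γ = 1`, and equivariance is an orbit property
(`IsEquivariantDetRepr.of_detReprEquivalent`, `DetReprEquivalent.lean`). In the second alternative
(`A' := A.map (rename Prod.swap)` equivariant) the variable-transpose is a ring homomorphism
applied entrywise, fixing constants, so `B.map (rename Prod.swap) = P · A' · Q`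
(resp. `P · A'ᵀ · Q`), and `det (B.map (rename Prod.swap)) = rename Prod.swap (det B) = per_k`
by the symmetry of the permanent.
-/

set_option linter.dupNamespace false

namespace Summit.ValiantsHypothesis.ValiantsHypothesis.Theorems.ProjectionStabilityOptStep.TransportGauge

open MvPolynomial Matrix
open Literature.Computability.AlgebraicComplexity

noncomputable section

/-- The generic permanent is symmetric in its variable matrix: `per(Xᵀ) = per(X)`
(`Matrix.permanent_transpose`). [folklore] -/
theorem rename_swap_perPoly {ι : Type*} [Fintype ι] [DecidableEq ι] (K : Type*)
    [CommSemiring K] : rename Prod.swap (perPoly ι K) = perPoly ι K := by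
  have h : rename (Prod.swap : ι × ι → ι × ι) (perPoly ι K) =
      ((Matrix.mvPolynomialX ι ι K).transpose).permanent := by
    simp [perPoly, Matrix.permanent, map_sum, map_prod, Matrix.mvPolynomialX, rename_X]
  rw [h, Matrix.permanent_transpose]
  rfl

/-- The variable-transpose `x_{ij} ↦ x_{ji}` applied entrywise commutes with a constant two-sided
gauge: `(P · M · Q)(xᵀ) = P · M(xᵀ) · Q` (it is a ring homomorphism fixing constants).
[folklore] -/
theorem map_rename_swap_gauge {k m : ℕ} (P Q : Matrix (Fin m) (Fin m) ℂ)
    (M : Matrix (Fin m) (Fin m) (MvPolynomial (Fin k × Fin k) ℂ)) :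
    (P.map C * M * Q.map C).map (rename Prod.swap) =
      P.map C * M.map (rename Prod.swap) * Q.map C := by
  have hC : (⇑(rename (Prod.swap : Fin k × Fin k → Fin k × Fin k) :
      MvPolynomial (Fin k × Fin k) ℂ →ₐ[ℂ] MvPolynomial (Fin k × Fin k) ℂ)) ∘
        (C : ℂ → MvPolynomial (Fin k × Fin k) ℂ) = C :=
    funext fun c => rename_C _ c
  rw [Matrix.map_mul, Matrix.map_mul, Matrix.map_map, Matrix.map_map, hC]

/-- The variable-transpose applied entrywise commutes with matrix transposition. [folklore] -/
theorem map_rename_swap_transpose {k m : ℕ}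
    (M : Matrix (Fin m) (Fin m) (MvPolynomial (Fin k × Fin k) ℂ)) :
    M.transpose.map (rename (Prod.swap : Fin k × Fin k → Fin k × Fin k)) =
      (M.map (rename Prod.swap)).transpose :=
  Matrix.transpose_map

/-- Determinant of the variable-transpose: `det (B(xᵀ)) = (det B)(xᵀ)` (`AlgHom.map_det`).
[folklore] -/
theorem det_map_rename_swap {k m : ℕ}
    (B : Matrix (Fin m) (Fin m) (MvPolynomial (Fin k × Fin k) ℂ)) :
    (B.map (rename (Prod.swap : Fin k × Fin k → Fin k × Fin k))).det =
      rename Prod.swap B.det := by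
  rw [AlgHom.map_det, AlgHom.mapMatrix_apply]

/-- A constant two-sided gauge, with an optional matrix transposition, is a `DetReprEquivalent Γ`
move with the trivial substitution `γ = 1 ∈ Γ`. [folklore] -/
theorem detReprEquivalent_of_gauge_or_transpose {k m : ℕ}
    (Γ : Subgroup (GL (Fin k × Fin k) ℂ))
    (A B : Matrix (Fin m) (Fin m) (MvPolynomial (Fin k × Fin k) ℂ)) (P Q : GL (Fin m) ℂ)
    (hB : B = (P : Matrix (Fin m) (Fin m) ℂ).map C * A * (Q : Matrix (Fin m) (Fin m) ℂ).map C
      ∨ B = (P : Matrix (Fin m) (Fin m) ℂ).map C * A.transpose *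
        (Q : Matrix (Fin m) (Fin m) ℂ).map C) :
    DetReprEquivalent Γ A B :=
  ⟨P, Q, 1, Γ.one_mem, by rwa [Matrix.linSubstEntries_one]⟩

/-- **S5 — transport of half-equivariance along constant gauge and matrix transposition.**
If `A`, or its variable-transpose `A.map (rename Prod.swap)`, is an exactly-lifted
`leftMonomialSubst`-equivariant affine determinantal representation of `per_k`, and
`B = P · A · Q` or `B = P · Aᵀ · Q` for constant invertible `P, Q` with `det B = per_k`, then
`B`, or its variable-transpose, is one as well (equivariance is a `DetReprEquivalent`-orbit
property, `IsEquivariantDetRepr.of_detReprEquivalent`; the variable-transpose commutes with the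
gauge moves and `per(Xᵀ) = per(X)`). [folklore] -/
theorem stub_halfEq_transport_gauge :
    ∀ (k m : ℕ) (A B : Matrix (Fin m) (Fin m) (MvPolynomial (Fin k × Fin k) ℂ)) (P Q : GL (Fin m) ℂ),
      (IsEquivariantDetRepr (leftMonomialSubst ℂ k) (perPoly (Fin k) ℂ) A ∨
        IsEquivariantDetRepr (leftMonomialSubst ℂ k) (perPoly (Fin k) ℂ) (A.map (rename Prod.swap))) →
      (B = (P : Matrix (Fin m) (Fin m) ℂ).map C * A * (Q : Matrix (Fin m) (Fin m) ℂ).map C ∨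
        B = (P : Matrix (Fin m) (Fin m) ℂ).map C * A.transpose * (Q : Matrix (Fin m) (Fin m) ℂ).map C) →
      B.det = perPoly (Fin k) ℂ →
      (IsEquivariantDetRepr (leftMonomialSubst ℂ k) (perPoly (Fin k) ℂ) B ∨
        IsEquivariantDetRepr (leftMonomialSubst ℂ k) (perPoly (Fin k) ℂ) (B.map (rename Prod.swap))) := by
  intro k m A B P Q hA hB hdet
  rcases hA with hA | hA
  · exact Or.inl (hA.of_detReprEquivalent
      (detReprEquivalent_of_gauge_or_transpose (leftMonomialSubst ℂ k) A B P Q hB) hdet)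
  · right
    have hdet' : (B.map (rename (Prod.swap : Fin k × Fin k → Fin k × Fin k))).det =
        perPoly (Fin k) ℂ := by
      rw [det_map_rename_swap, hdet, rename_swap_perPoly]
    refine hA.of_detReprEquivalent (detReprEquivalent_of_gauge_or_transpose
      (leftMonomialSubst ℂ k) (A.map (rename Prod.swap)) (B.map (rename Prod.swap)) P Q ?_) hdet'
    rcases hB with rfl | rfl
    · exact Or.inl (map_rename_swap_gauge _ _ _)
    · exact Or.inr (by rw [map_rename_swap_gauge, map_rename_swap_transpose])

end

end Summit.ValiantsHypothesis.ValiantsHypothesis.Theorems.ProjectionStabilityOptStep.TransportGauge
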